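import Summits.Ventures.PackingBounds.ThreePointCert.CheckFKS

/-!
# Kronecker-substitution validation of the three-point part `FI`: bounds and soundness

Framing: lottery ticket; floor = certified bounds/negative ranges. Venture `PackingBounds`
(cell `pub-packcert`), three-point SDP family — kernel-checking infrastructure.

Second half of `ThreePointCert.CheckFKS` (split for the 400-line rule): the absolute coefficient
sum (`absSum_gF`) and the exponent box (`exps_gF`) of the ghost polynomial `gF`, and the soundness
theorem `fexpValidG_of_fCheckKS : fCheckKS w D c.n c.d c.F FP = true → FexpValidG c FP` (the
hypothesis `SoundNN.PolysNN3.hF`), via `KroneckerEval.eval_eq_zero_of_kronecker`. No statement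
about certificates changes.
-/

noncomputable section

namespace Summit.Ventures.PackingBounds.ThreePointCert

open Literature.Geometry.DiscreteGeometry Literature.Geometry.DiscreteGeometry.PolyCert
open Literature.Geometry.DiscreteGeometry.PolyCert.SPoly

/-! ### Absolute coefficient sums -/

/-- `absSum (smul c p) = |c| · absSum p`. -/
theorem absSum_smul (c : ℤ) (p : SPoly) : absSum (smul c p) = c.natAbs * absSum p := by
  induction p with
  | nil => simp [smul, absSum]
  | cons mc p ih =>
    simp only [smul, List.map_cons, absSum, List.sum_cons, Int.natAbs_mul] at ih ⊢
    rw [ih]; ring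

/-- The permutations preserve `absSum`. -/
theorem absSum_perms (p : SPoly) : absSum (permBAC p) = absSum p ∧ absSum (permACB p) = absSum p ∧
    absSum (permCBA p) = absSum p ∧ absSum (permCAB p) = absSum p ∧ absSum (permBCA p) = absSum p := by
  simp [absSum, permBAC, permACB, permCBA, permCAB, permBCA, List.map_map, Function.comp_def]

/-- `absSum (sym6P p) = 6 · absSum p`. -/
theorem absSum_sym6P (p : SPoly) : absSum (sym6P p) = 6 * absSum p := by
  obtain ⟨h1, h2, h3, h4, h5⟩ := absSum_perms p
  simp only [sym6P, absSum_append, h1, h2, h3, h4, h5]; ring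

/-- `absSum (qiRaw n k) = qiAbs n k`. -/
theorem absSum_qiRaw (n : ℕ) : ∀ k, absSum (qiRaw n k) = qiAbs n k
  | 0 => rfl
  | 1 => by rw [qiRaw, qiAbs, absSum_smul]; rfl
  | j + 2 => by
    have hs : absSum sigP = 4 := rfl
    have hp : absSum piP = 4 := rfl
    rw [qiRaw, qiAbs, absSum_append, absSum_smul, absSum_smul, absSum_mul, absSum_mul,
      absSum_qiRaw n (j + 1), absSum_qiRaw n j, Int.natAbs_neg, hs, hp]

/-- `absSum (phiUA w a) = Σ|w|`. -/
theorem absSum_phiUA : ∀ (w : List ℤ) (a : ℕ), absSum (phiUA w a) = absList w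
  | [], a => rfl
  | c :: cs, a => by
    simp only [phiUA, absSum, absList, List.map_cons, List.sum_cons] at *
    rw [← absList, ← absSum_phiUA cs (a + 1)]; rfl
/-- `absSum (phiVA w a) = Σ|w|`. -/
theorem absSum_phiVA : ∀ (w : List ℤ) (a : ℕ), absSum (phiVA w a) = absList w
  | [], a => rfl
  | c :: cs, a => by
    simp only [phiVA, absSum, absList, List.map_cons, List.sum_cons] at *
    rw [← absList, ← absSum_phiVA cs (a + 1)]; rfl

/-- `absSum (gWs n k ws) = gWsAbs n k ws`. -/
theorem absSum_gWs (n k : ℕ) : ∀ ws : List (List ℤ), absSum (gWs n k ws) = gWsAbs n k ws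
  | [] => rfl
  | w :: ws => by
    rw [gWs, gWsAbs, absSum_append, absSum_gWs n k ws, gW, absSum_sym6P, absSum_mul, absSum_mul,
      absSum_phiUA, absSum_phiVA, absSum_qiRaw]

/-- `absSum (gF n d bs) = gFAbs n d bs`. -/
theorem absSum_gF (n d : ℕ) : ∀ bs : List FBlk, absSum (gF n d bs) = gFAbs n d bs
  | [] => rfl
  | b :: bs => by
    rw [gF, gFAbs, absSum_append, absSum_smul, absSum_gWs, absSum_gF n d bs, Int.natAbs_natCast]

/-! ### Exponents -/

/-- Exponents of `qiRaw n k` are `≤ k`. -/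
theorem exps_qiRaw (n : ℕ) : ∀ k, ∀ mc ∈ qiRaw n k, mc.1.a ≤ k ∧ mc.1.b ≤ k ∧ mc.1.c ≤ k
  | 0, mc, h => by simp [qiRaw, C] at h; subst h; simp
  | 1, mc, h => by
    simp only [qiRaw, smul, sigP, List.map_cons, List.map_nil, List.mem_cons, List.mem_nil_iff,
      or_false] at h
    rcases h with rfl | rfl <;> simp
  | j + 2, mc, h => by
    simp only [qiRaw, smul, List.mem_append, List.mem_map] at h
    rcases h with ⟨a, ha, rfl⟩ | ⟨a, ha, rfl⟩
    · obtain ⟨s, hs, q, hq, e⟩ := mem_mul _ _ a ha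
      have hq' := exps_qiRaw n (j + 1) q hq
      simp only [sigP, List.mem_cons, List.mem_nil_iff, or_false] at hs
      rcases hs with rfl | rfl <;> · simp only [e, Mono.mul]; omega
    · obtain ⟨s, hs, q, hq, e⟩ := mem_mul _ _ a ha
      have hq' := exps_qiRaw n j q hq
      simp only [piP, List.mem_cons, List.mem_nil_iff, or_false] at hs
      rcases hs with rfl | rfl | rfl | rfl <;> · simp only [e, Mono.mul]; omega

/-- Exponents of `phiUA w a`: `a`-exponent `< a + |w|`, others `0`. -/
theorem exps_phiUA : ∀ (w : List ℤ) (a : ℕ), ∀ mc ∈ phiUA w a, mc.1.a < a + w.length ∧ mc.1.b = 0 ∧ mc.1.c = 0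
  | [], a, mc, h => by simp [phiUA] at h
  | c :: cs, a, mc, h => by
    simp only [phiUA, List.mem_cons] at h
    rcases h with rfl | h
    · simp
    · have := exps_phiUA cs (a + 1) mc h; simp only [List.length_cons]; omega
/-- Exponents of `phiVA w a`. -/
theorem exps_phiVA : ∀ (w : List ℤ) (a : ℕ), ∀ mc ∈ phiVA w a, mc.1.a = 0 ∧ mc.1.b < a + w.length ∧ mc.1.c = 0
  | [], a, mc, h => by simp [phiVA] at h
  | c :: cs, a, mc, h => by
    simp only [phiVA, List.mem_cons] at h
    rcases h with rfl | h
    · simp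
    · have := exps_phiVA cs (a + 1) mc h; simp only [List.length_cons]; omega

/-- Exponents of `gW n k w` are `< |w| + k`. -/
theorem exps_gW (n k : ℕ) (w : List ℤ) (mc : Mono × ℤ) (h : mc ∈ gW n k w) :
    mc.1.a < w.length + k ∧ mc.1.b < w.length + k ∧ mc.1.c < w.length + k := by
  have inner : ∀ m ∈ mul (mul (phiUA w 0) (phiVA w 0)) (qiRaw n k),
      m.1.a < w.length + k ∧ m.1.b < w.length + k ∧ m.1.c < w.length + k := by
    intro m hm
    obtain ⟨pq, hpq, q, hq, e⟩ := mem_mul _ _ m hm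
    obtain ⟨p1, hp1, p2, hp2, e2⟩ := mem_mul _ _ pq hpq
    have h1 := exps_phiUA w 0 p1 hp1
    have h2 := exps_phiVA w 0 p2 hp2
    have h3 := exps_qiRaw n k q hq
    rw [e, e2]; simp only [Mono.mul]; omega
  simp only [gW, sym6P, List.mem_append, permBAC, permACB, permCBA, permCAB, permBCA,
    List.mem_map] at h
  rcases h with ((((h | ⟨m, hm, rfl⟩) | ⟨m, hm, rfl⟩) | ⟨m, hm, rfl⟩) | ⟨m, hm, rfl⟩) | ⟨m, hm, rfl⟩
  · exact inner mc h
  all_goals (have := inner m hm; simp only; omega)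

/-- Exponents of the ghost are `< D` under the kernel side condition. -/
theorem exps_gF (n d D : ℕ) : ∀ bs : List FBlk,
    (bs.all fun b => b.ws.all fun w' => decide (w'.length + b.k ≤ D)) = true →
      ∀ mc ∈ gF n d bs, mc.1.a < D ∧ mc.1.b < D ∧ mc.1.c < D
  | [], _, mc, h => by simp [gF] at h
  | b :: bs, hall, mc, h => by
    rw [List.all_cons, Bool.and_eq_true] at hall
    rw [gF, List.mem_append] at h
    rcases h with h | h
    · simp only [smul, List.mem_map] at h
      obtain ⟨m, hm, rfl⟩ := h
      have hws : ∀ ws : List (List ℤ), (ws.all fun w' => decide (w'.length + b.k ≤ D)) = true →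
          m ∈ gWs n b.k ws → m.1.a < D ∧ m.1.b < D ∧ m.1.c < D := by
        intro ws
        induction ws with
        | nil => intro _ h; simp [gWs] at h
        | cons w ws ih =>
          intro hw h
          rw [List.all_cons, Bool.and_eq_true, decide_eq_true_eq] at hw
          rw [gWs, List.mem_append] at h
          rcases h with h | h
          · have := exps_gW n b.k w m h; omega
          · exact ih hw.2 h
      exact hws b.ws hall.1 hm
    · exact exps_gF n d D bs hall.2 mc h

/-! ### Soundness -/

/-- **Soundness of the Kronecker-substitution check of the three-point part**: `FP` has the values
of `FPolyG c.n c.d c.F` (everywhere, in particular on the box: `FexpValidG`). -/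
theorem fexpValidG_of_fCheckKS (w D : ℕ) (c : Cert3) (FP : SPoly)
    (h : fCheckKS w D c.n c.d c.F FP = true) : FexpValidG c FP := by
  unfold fCheckKS at h
  simp only [Bool.and_eq_true, decide_eq_true_eq] at h
  obtain ⟨⟨⟨hlen, hbox⟩, hw⟩, hval⟩ := h
  rw [enc_eq, ← evalZ_gF] at hval
  intro u v t _ _ _
  have hQ := eval_eq_zero_of_kronecker w D (gF c.n c.d c.F ++ neg FP)
    (fun mc hmc => by
      rcases List.mem_append.1 hmc with h | h
      · exact exps_gF c.n c.d D c.F hlen mc h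
      · exact inBox_neg D FP hbox mc h)
    (by rw [absSum_append, absSum_neg, absSum_gF]; omega)
    (by rw [evalZ_append, evalZ_neg, ← hval]; ring) u v t
  rw [eval_append, eval_neg, eval_gF] at hQ
  linarith

end Summit.Ventures.PackingBounds.ThreePointCert

end
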